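import Literature.AlgebraicGeometry.Resolution.SpreadsShapedFromGenericPointProof
import Literature.AlgebraicGeometry.Resolution.KollarBlowupSequenceFunctorsProofs
import HarnessLib

/-!
# Discharged fact: canonical (functorial) resolution of singularities in characteristic zero
# (Bierstone–Grigoriev–Milman–Włodarczyk 2011, Thm. 8.0.5; Kollár 2007, Thms. 3.103, 3.107)

`Literature.AlgebraicGeometry.Resolution.BierstoneGrigorievMilmanWlodarczyk2011_canonical`
(`Resolution/CanonicalResolution`) was reduced in the tree to Kollár, *Lectures on Resolution of
Singularities* (2007), Thm. 3.103 and Thm. 3.107 (the functorial blow-up sequence functors) by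
`canonical_of_kollarThms` (`Resolution/SpreadsShapedFromGenericPointProof`, through the spreading-out
from the generic point, `spreadsShapedFromGenericPoint_holds`).  Both Kollár theorems are theorems of
the tree (`Kollar2007Thm3_103_holds`, `Kollar2007Thm3_107_holds`,
`Resolution/KollarBlowupSequenceFunctorsProofs`), so the fact is discharged by the one-line
application below.  No statement is changed; no definition, no new named fact (D-0026); net
Literature debt **−1**.

## References

* E. Bierstone, D. Grigoriev, P. Milman, J. Włodarczyk, *Effective Hironaka resolution and its
  complexity*, Asian J. Math. 15 (2011), Thm. 8.0.5 with Cor. 8.0.6–8.0.7.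
  [BierstoneGrigorievMilmanWlodarczyk2011]
* J. Kollár, *Lectures on Resolution of Singularities*, Ann. of Math. Studies 166 (2007), Thm. 3.103,
  Thm. 3.107. [Kollar2007]
-/

namespace Literature.AlgebraicGeometry.Resolution

/-- **Canonical resolution of singularities in characteristic zero (BGMW 2011, Thm. 8.0.5) — the
named fact `BierstoneGrigorievMilmanWlodarczyk2011_canonical` holds** (`canonical_of_kollarThms`
applied to `Kollar2007Thm3_103_holds` and `Kollar2007Thm3_107_holds`).
[cite: BierstoneGrigorievMilmanWlodarczyk2011, Thm. 8.0.5 with Cor. 8.0.6–8.0.7]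
[cite: Kollar2007, Thm. 3.103 and Thm. 3.107] -/
theorem BierstoneGrigorievMilmanWlodarczyk2011_canonical_holds :
    BierstoneGrigorievMilmanWlodarczyk2011_canonical :=
  canonical_of_kollarThms Kollar2007Thm3_103_holds Kollar2007Thm3_107_holds

end Literature.AlgebraicGeometry.Resolution
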